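import Mathlib
import Summits.Ventures.PercRepro2.ThreePointConn

/-!
# Rooted events: the three-point and same-target inequalities for cluster events of a root (PercRepro2, mine-1)

An increasing event `E` on edge sets is *rooted at `s`* (`Rooted ends s E`) if the `s`-component of
any witness is again a witness: connection events `{s ↔ a}`, their conjunctions, and every increasing
event determined by the open cluster of `s` are rooted.  For rooted `E`, `F` and `C = {s ↔ t}` the
last-vertex lemma gives `(E ∘ F) ∩ C ⊆ ((E ∩ C) ∘ F) ∪ (E ∘ (F ∩ C))` (`dOcc_rooted_conn`), hence for
every product measure (`MINE-1.md` §17.11):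

* `three_point_rooted`: `P((E∘F) ∩ C) + P(E∩C)·P(F∩C) ≤ P(E∩C)·P(F) + P(E)·P(F∩C)`;
* `same_target_rooted`: `P((E∘E) ∩ C)·P(C) ≤ P(E∩C)²` — conditional BK for the self-disjoint
  occurrence of any cluster event of the root (row M1-R2c is the case `E = {s ↔ a}`).

Here `P X = ∑_{S ⊆ U, X S} wt U p S` on the full edge set `U = univ`; `harris_wt` transports typer-1's
Harris inequality to these sums through `prob_eq_sum_wt`.
-/

namespace Summit.Ventures.PercRepro2

open ReimerCube

section Rooted

variable {V : Type*} {E : Type*} [DecidableEq E]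

/-- An increasing event on edge sets is rooted at `s` if the `s`-component of every witness is a
witness. -/
def Rooted (ends : E → Sym2 V) (s : V) (P : Finset E → Prop) : Prop :=
  Incr P ∧ ∀ K : Finset E, (∀ T, K ⊆ T → P T) → ∀ T, sComp ends K s ⊆ T → P T

/-- Rooted events are increasing. -/
lemma Rooted.incr {ends : E → Sym2 V} {s : V} {P : Finset E → Prop} (h : Rooted ends s P) :
    Incr P := h.1

/-- Connection events of the root are rooted. -/
lemma rooted_carries (ends : E → Sym2 V) (s a : V) :
    Rooted ends s (fun S => Carries ends S s a) := by
  refine ⟨incr_carries ends s a, ?_⟩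
  intro K hK T hT
  exact Carries.mono hT (carries_sComp (hK K (Finset.Subset.refl K)))

/-- Conjunctions of rooted events are rooted. -/
lemma Rooted.and {ends : E → Sym2 V} {s : V} {P Q : Finset E → Prop} (hP : Rooted ends s P)
    (hQ : Rooted ends s Q) : Rooted ends s (fun S => P S ∧ Q S) := by
  refine ⟨fun _ _ h hx => ⟨hP.1 h hx.1, hQ.1 h hx.2⟩, ?_⟩
  intro K hK T hT
  exact ⟨hP.2 K (fun T' h => (hK T' h).1) T hT, hQ.2 K (fun T' h => (hK T' h).2) T hT⟩

/-- `ofFinset (S \ L) = closeOn (ofFinset S) L` (no finiteness needed). -/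
lemma ofFinset_sdiff (S L : Finset E) : ofFinset (S \ L) = closeOn (ofFinset S) L := by
  funext e
  by_cases he : e ∈ L
  · simp [ofFinset, closeOn, he]
  · simp [ofFinset, closeOn, he]

/-- **Last-vertex decomposition for rooted events**: if `S` carries disjoint witnesses of rooted `P`
and `Q` and an `s–t` path, then it carries disjoint witnesses of `P ∩ {s↔t}` and `Q`, or of `P` and
`Q ∩ {s↔t}`. -/
theorem dOcc_rooted_conn {ends : E → Sym2 V} {s t : V} {P Q : Finset E → Prop}
    (hP : Rooted ends s P) (hQ : Rooted ends s Q) {S : Finset E} (h : DOcc P Q S)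
    (hst : Carries ends S s t) :
    DOcc (fun T => P T ∧ Carries ends T s t) Q S ∨ DOcc P (fun T => Q T ∧ Carries ends T s t) S := by
  obtain ⟨K, L, hKS, hLS, hKL, hPK, hQL⟩ := h
  have hKo : ∀ e ∈ K, ofFinset S e = true := fun e he => ofFinset_eq_true_iff.2 (hKS he)
  have hLo : ∀ e ∈ L, ofFinset S e = true := fun e he => ofFinset_eq_true_iff.2 (hLS he)
  rcases conn_closeOn_or (ends := ends) hKL hKo hLo hst with h | h
  · left
    refine ⟨S \ sComp ends L s, sComp ends L s, Finset.sdiff_subset,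
      (sComp_subset ends L s).trans hLS, Finset.sdiff_disjoint, ?_, hQ.2 L hQL⟩
    intro T hT
    have hK' : K ⊆ S \ sComp ends L s := by
      intro e he
      rw [Finset.mem_sdiff]
      exact ⟨hKS he, fun h' => Finset.disjoint_left.1 hKL he (sComp_subset ends L s h')⟩
    refine ⟨hPK T (hK'.trans hT), Carries.mono hT ?_⟩
    show Conn ends (ofFinset (S \ sComp ends L s)) s t
    rw [ofFinset_sdiff]
    exact h
  · right
    refine ⟨sComp ends K s, S \ sComp ends K s, (sComp_subset ends K s).trans hKS,
      Finset.sdiff_subset, Finset.disjoint_sdiff, hP.2 K hPK, ?_⟩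
    intro T hT
    have hL' : L ⊆ S \ sComp ends K s := by
      intro e he
      rw [Finset.mem_sdiff]
      exact ⟨hLS he, fun h' => Finset.disjoint_right.1 hKL he (sComp_subset ends K s h')⟩
    refine ⟨hQL T (hL'.trans hT), Carries.mono hT ?_⟩
    show Conn ends (ofFinset (S \ sComp ends K s)) s t
    rw [ofFinset_sdiff]
    exact h

end Rooted

section Weighted

variable {V : Type*} {E : Type*} [Fintype E] [DecidableEq E]

open Classical in
/-- **Harris for product weights on edge sets**: for increasing `P`, `Q`,
`(∑_{P} wt)·(∑_{Q} wt) ≤ ∑_{P ∧ Q} wt` (transported from `prob_mul_prob_le_prob_inter`). -/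
theorem harris_wt (p : E → ℝ) (hp : IsProbVec p) (P Q : Finset E → Prop) (hP : Incr P)
    (hQ : Incr Q) :
    (∑ S ∈ Finset.univ.powerset.filter P, wt Finset.univ p S)
        * (∑ S ∈ Finset.univ.powerset.filter Q, wt Finset.univ p S)
      ≤ ∑ S ∈ Finset.univ.powerset.filter (fun S => P S ∧ Q S), wt Finset.univ p S := by
  let X : Set (Config E) := {ω | P (openSet ω)}
  let Y : Set (Config E) := {ω | Q (openSet ω)}
  have hX : IsUpperSet X := by
    intro ω ω' h hω
    refine hP (fun e he => ?_) hω
    rw [mem_openSet] at he ⊢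
    have := h e
    rw [he] at this
    exact Bool.le_iff_imp.1 this rfl
  have hY : IsUpperSet Y := by
    intro ω ω' h hω
    refine hQ (fun e he => ?_) hω
    rw [mem_openSet] at he ⊢
    have := h e
    rw [he] at this
    exact Bool.le_iff_imp.1 this rfl
  have h := prob_mul_prob_le_prob_inter hp hX hY
  rw [prob_eq_sum_wt, prob_eq_sum_wt, prob_eq_sum_wt] at h
  have eX : ∀ S : Finset E, ofFinset S ∈ X ↔ P S := fun S => by
    show P (openSet (ofFinset S)) ↔ P S
    rw [openSet_ofFinset]
  have eY : ∀ S : Finset E, ofFinset S ∈ Y ↔ Q S := fun S => by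
    show Q (openSet (ofFinset S)) ↔ Q S
    rw [openSet_ofFinset]
  rw [sum_filter_congr_pred eX, sum_filter_congr_pred eY,
    sum_filter_congr_pred (fun S => (Set.mem_inter_iff _ _ _).trans (and_congr (eX S) (eY S)))] at h
  exact h

open Classical in
/-- **Three-point inequality for rooted events** (MINE-1 §17.11): for rooted `P`, `Q` and
`C = {s ↔ t}`, `P((P∘Q) ∩ C) + P(P∩C)·P(Q∩C) ≤ P(P∩C)·P(Q) + P(P)·P(Q∩C)`. -/
theorem three_point_rooted (p : E → ℝ) (hp : IsProbVec p) (ends : E → Sym2 V) (s t : V)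
    (P Q : Finset E → Prop) (hP : Rooted ends s P) (hQ : Rooted ends s Q) :
    (∑ S ∈ Finset.univ.powerset.filter (fun S => DOcc P Q S ∧ Carries ends S s t), wt Finset.univ p S)
      + (∑ S ∈ Finset.univ.powerset.filter (fun S => P S ∧ Carries ends S s t), wt Finset.univ p S)
          * (∑ S ∈ Finset.univ.powerset.filter (fun S => Q S ∧ Carries ends S s t), wt Finset.univ p S)
    ≤ (∑ S ∈ Finset.univ.powerset.filter (fun S => P S ∧ Carries ends S s t), wt Finset.univ p S)
          * (∑ S ∈ Finset.univ.powerset.filter Q, wt Finset.univ p S)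
      + (∑ S ∈ Finset.univ.powerset.filter P, wt Finset.univ p S)
          * (∑ S ∈ Finset.univ.powerset.filter (fun S => Q S ∧ Carries ends S s t), wt Finset.univ p S) := by
  have hp' : ∀ i, 0 ≤ p i ∧ p i ≤ 1 := fun i => ⟨hp.nonneg i, hp.le_one i⟩
  have key := three_point_weighted Finset.univ p hp' P Q (fun S => Carries ends S s t)
    hP.incr hQ.incr (incr_carries ends s t)
  have hL : (∑ S ∈ Finset.univ.powerset.filter (fun S => DOcc P Q S ∧ Carries ends S s t),
        wt Finset.univ p S)
      ≤ ∑ S ∈ Finset.univ.powerset.filter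
          (fun S => DOcc (fun T => P T ∧ Carries ends T s t) Q S ∨
            DOcc P (fun T => Q T ∧ Carries ends T s t) S), wt Finset.univ p S := by
    apply Finset.sum_le_sum_of_subset_of_nonneg
    · intro S hS
      rw [Finset.mem_filter] at hS ⊢
      exact ⟨hS.1, dOcc_rooted_conn hP hQ hS.2.1 hS.2.2⟩
    · intro S _ _
      exact wt_nonneg Finset.univ p hp' S
  linarith [hL, key]

open Classical in
/-- **Conditional BK for the self-disjoint occurrence of a rooted event** (MINE-1 §17.11; row
M1-R2c is the case `P = {s ↔ a}`): `P((P∘P) ∩ {s↔t})·P(s↔t) ≤ P(P ∩ {s↔t})²`. -/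
theorem same_target_rooted (p : E → ℝ) (hp : IsProbVec p) (ends : E → Sym2 V) (s t : V)
    (P : Finset E → Prop) (hP : Rooted ends s P) :
    (∑ S ∈ Finset.univ.powerset.filter (fun S => DOcc P P S ∧ Carries ends S s t), wt Finset.univ p S)
        * (∑ S ∈ Finset.univ.powerset.filter (fun S => Carries ends S s t), wt Finset.univ p S)
      ≤ (∑ S ∈ Finset.univ.powerset.filter (fun S => P S ∧ Carries ends S s t), wt Finset.univ p S) ^ 2 := by
  have hp' : ∀ i, 0 ≤ p i ∧ p i ≤ 1 := fun i => ⟨hp.nonneg i, hp.le_one i⟩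
  have hPC : Incr (fun S => P S ∧ Carries ends S s t) :=
    fun _ _ h hx => ⟨hP.incr h hx.1, Carries.mono h hx.2⟩
  -- step 1: P((P∘P) ∩ C) ≤ P(P ∩ C) · P(P)   (last-vertex + BK)
  have hBK := bk_weighted p hp' (fun S => P S ∧ Carries ends S s t) P hPC hP.incr
  have hL : (∑ S ∈ Finset.univ.powerset.filter (fun S => DOcc P P S ∧ Carries ends S s t),
        wt Finset.univ p S)
      ≤ ∑ S ∈ Finset.univ.powerset.filter
          (fun S => DOcc (fun T => P T ∧ Carries ends T s t) P S), wt Finset.univ p S := by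
    apply Finset.sum_le_sum_of_subset_of_nonneg
    · intro S hS
      rw [Finset.mem_filter] at hS ⊢
      refine ⟨hS.1, ?_⟩
      rcases dOcc_rooted_conn hP hP hS.2.1 hS.2.2 with h | h
      · exact h
      · obtain ⟨K, L, hK, hL, hKL, hPK, hQL⟩ := h
        exact ⟨L, K, hL, hK, hKL.symm, hQL, hPK⟩
    · intro S _ _
      exact wt_nonneg Finset.univ p hp' S
  have h1 : (∑ S ∈ Finset.univ.powerset.filter (fun S => DOcc P P S ∧ Carries ends S s t),
        wt Finset.univ p S)
      ≤ (∑ S ∈ Finset.univ.powerset.filter (fun S => P S ∧ Carries ends S s t), wt Finset.univ p S)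
          * (∑ S ∈ Finset.univ.powerset.filter P, wt Finset.univ p S) := by
    refine hL.trans (hBK.trans (le_of_eq ?_))
    exact congrArg₂ (· * ·) (sum_filter_congr_pred fun _ => Iff.rfl)
      (sum_filter_congr_pred fun _ => Iff.rfl)
  -- step 2: Harris: P(P)·P(C) ≤ P(P ∩ C)
  have h2 := harris_wt p hp P (fun S => Carries ends S s t) hP.incr (incr_carries ends s t)
  have hC : 0 ≤ ∑ S ∈ Finset.univ.powerset.filter (fun S => Carries ends S s t), wt Finset.univ p S :=
    Finset.sum_nonneg fun S _ => wt_nonneg Finset.univ p hp' S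
  have hPC' : 0 ≤ ∑ S ∈ Finset.univ.powerset.filter (fun S => P S ∧ Carries ends S s t),
      wt Finset.univ p S :=
    Finset.sum_nonneg fun S _ => wt_nonneg Finset.univ p hp' S
  calc (∑ S ∈ Finset.univ.powerset.filter (fun S => DOcc P P S ∧ Carries ends S s t),
          wt Finset.univ p S)
        * (∑ S ∈ Finset.univ.powerset.filter (fun S => Carries ends S s t), wt Finset.univ p S)
      ≤ (∑ S ∈ Finset.univ.powerset.filter (fun S => P S ∧ Carries ends S s t), wt Finset.univ p S)
          * (∑ S ∈ Finset.univ.powerset.filter P, wt Finset.univ p S)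
          * (∑ S ∈ Finset.univ.powerset.filter (fun S => Carries ends S s t), wt Finset.univ p S) :=
        mul_le_mul_of_nonneg_right h1 hC
    _ = (∑ S ∈ Finset.univ.powerset.filter (fun S => P S ∧ Carries ends S s t), wt Finset.univ p S)
          * ((∑ S ∈ Finset.univ.powerset.filter P, wt Finset.univ p S)
            * (∑ S ∈ Finset.univ.powerset.filter (fun S => Carries ends S s t), wt Finset.univ p S)) := by
        ring
    _ ≤ (∑ S ∈ Finset.univ.powerset.filter (fun S => P S ∧ Carries ends S s t), wt Finset.univ p S)
          * (∑ S ∈ Finset.univ.powerset.filter (fun S => P S ∧ Carries ends S s t), wt Finset.univ p S) :=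
        mul_le_mul_of_nonneg_left h2 hPC'
    _ = (∑ S ∈ Finset.univ.powerset.filter (fun S => P S ∧ Carries ends S s t), wt Finset.univ p S) ^ 2 := by
        ring

end Weighted

end Summit.Ventures.PercRepro2
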